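import Mathlib
import Summits.BirchSwinnertonDyer.BirchSwinnertonDyer.Theorems.ManinLocalTwoThreeThreeDvdModularDegree
import Summits.BirchSwinnertonDyer.Rank1Residual.ManinAdditive.CuspUnipotentDegreeLaw
import HarnessLib

/-!
# E-an-4♯ `CuspSymbolInLatticeForcesThreeAtTwo` holds: `{∞, 1/(N/4)}_f ∈ Λ_f ⟹ 3 ∣ deg φ_D` at `4 ∥ N`

Summit `BirchSwinnertonDyer`, sub-problem `BirchSwinnertonDyer`, route `ManinLocalTwoThree`; width seat `bsd-line-manin23-p2`
(gen 9), `--supports` the crux C2 `ManinOddAtFour` (stmt-BirchSwinnertonDyer-22967).  Cell `bsd-f2-manin`, an lens leaf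
`…ManinAdditive.CuspUnipotentDegreeLaw` (E-an-4♯, «THEOREM TARGET — the factorisation step»; Watkins 2002 §4).  The content is
the seat's gen-8 E-an-46 `threeDvdModularDegreeOfCuspImageZero_holds` (`φ_D([1/M]) = O ⟹ 3 ∣ deg φ_D` at level `4M`, `M` odd, by
fibre counting with `τ₃ = w(4)t`); this file supplies the binder glue: conductor level `N = N_W` with `2² ∣ N`, `2³ ∤ N`, and the
symbol hypothesis `{∞, 1/(N/4)}_f ∈ Λ_f`, which gives `φ_D([1/(N/4)]) = O` by `c·Λ_f ⊆ Λ_W` (`smul_periodLattice_le`; the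
lattice-optimality binder of the row is not needed).

PROVED here (no `sorry`): `three_dvd_modularDegree_of_symbol_mem` (any level `N` with `4 ∥ N`, any datum),
**`cuspSymbolInLatticeForcesThreeAtTwo_holds : CuspSymbolInLatticeForcesThreeAtTwo`** (E-an-4♯ BY NAME).
BSD is not proved by this; Manin's conjecture is not proved by this.
-/

set_option autoImplicit false
set_option linter.dupNamespace false

noncomputable section

open scoped MatrixGroups ModularForm
open CongruenceSubgroup
open Literature.NumberTheory.EllipticCurves Literature.NumberTheory.EllipticCurves.ModularForms
open Summit.BirchSwinnertonDyer.Rank1Residual.ManinAdditive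

namespace Summit.BirchSwinnertonDyer.BirchSwinnertonDyer.Theorems.ManinLocalTwoThree

/-- **`{∞, 1/(N/4)}_f ∈ Λ_f ⟹ 3 ∣ deg φ_D`** for every datum at a level `N` with `4 ∥ N` (any curve; no optimality). -/
theorem three_dvd_modularDegree_of_symbol_mem {W : WeierstrassCurve ℚ} [W.IsElliptic] {N : ℕ} [NeZero N]
    (D : ModularParametrizationData W N) (h4 : 2 ^ 2 ∣ N) (h8 : ¬ 2 ^ 3 ∣ N)
    (hmem : modularSymbol D.f (1 / ((N / 4 : ℕ) : ℚ)) ∈ periodLattice D.f) : 3 ∣ D.modularDegree := by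
  obtain ⟨M, rfl⟩ : 4 ∣ N := by simpa using h4
  have hM : Odd M := by
    rcases Nat.even_or_odd M with ⟨k, hk⟩ | hodd
    · exact absurd (show 2 ^ 3 ∣ 4 * M from ⟨k, by rw [hk]; ring⟩) h8
    · exact hodd
  have hdiv : 4 * M / 4 = M := Nat.mul_div_cancel_left M (by norm_num)
  rw [hdiv] at hmem
  exact threeDvdModularDegreeOfCuspImageZero_holds W hM D
    ((D.uniformize_eq_zero_iff _).mpr (D.smul_periodLattice_le _ hmem))

/-- **E-an-4♯ `CuspSymbolInLatticeForcesThreeAtTwo` IS A THEOREM.**  BSD is not proved by this. -/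
theorem cuspSymbolInLatticeForcesThreeAtTwo_holds : CuspSymbolInLatticeForcesThreeAtTwo := by
  intro W _ _ _ D _ h4 h8 hmem
  exact three_dvd_modularDegree_of_symbol_mem D h4 h8 hmem

end Summit.BirchSwinnertonDyer.BirchSwinnertonDyer.Theorems.ManinLocalTwoThree

end
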